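import Summits.BirchSwinnertonDyer.BirchSwinnertonDyer.Theses.EisensteinDepletionAtTwo
import Literature.NumberTheory.EllipticCurves.KubotaLeopoldtTwoNumerator
import Literature.NumberTheory.EllipticCurves.EisensteinDedekindMeasureTwo
import Summits.BirchSwinnertonDyer.BirchSwinnertonDyer.Theorems.EisensteinDepletionAtTwoStarEulerOrder
import Summits.BirchSwinnertonDyer.BirchSwinnertonDyer.Theorems.EisensteinDepletionAtTwoStarTransfer
import Summits.BirchSwinnertonDyer.BirchSwinnertonDyer.Theorems.EisensteinDepletionAtTwoStarKlTwoWitness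
import Summits.BirchSwinnertonDyer.BirchSwinnertonDyer.Theorems.EisensteinDepletionAtTwoStarCoreReduction
import Summits.BirchSwinnertonDyer.BirchSwinnertonDyer.Theorems.EisensteinDepletionAtTwoStarDefs
import Summits.BirchSwinnertonDyer.BirchSwinnertonDyer.Theorems.EisensteinDepletionAtTwoStarEisFiniteLevel
import Summits.BirchSwinnertonDyer.BirchSwinnertonDyer.Theorems.EisensteinDepletionAtTwoStarGlueFinCloser
import Summits.BirchSwinnertonDyer.BirchSwinnertonDyer.Theorems.EisensteinDepletionAtTwoStarEisEight
import Summits.BirchSwinnertonDyer.BirchSwinnertonDyer.Theorems.EisensteinDepletionAtTwoStarSymbCurrencies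
import Summits.BirchSwinnertonDyer.BirchSwinnertonDyer.Theorems.EisensteinDepletionAtTwoStarCuspValues
import Summits.BirchSwinnertonDyer.BirchSwinnertonDyer.Theorems.EisensteinDepletionAtTwoStarSymbCFifteen
import Summits.BirchSwinnertonDyer.BirchSwinnertonDyer.Theorems.EisensteinDepletionAtTwoStarHabitatLevel
import Summits.BirchSwinnertonDyer.BirchSwinnertonDyer.Theorems.EisensteinDepletionAtTwoStarGlueFinScaleLemmas
import Summits.BirchSwinnertonDyer.BirchSwinnertonDyer.Theorems.EisensteinDepletionAtTwoStarEisOddWitness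
import Summits.BirchSwinnertonDyer.BirchSwinnertonDyer.Theorems.EisensteinDepletionAtTwoStarEisEightGlobal
import Summits.BirchSwinnertonDyer.BirchSwinnertonDyer.Theorems.EisensteinDepletionAtTwoStarPlusPrimitiveGlobal
import Summits.BirchSwinnertonDyer.BirchSwinnertonDyer.Theorems.EisensteinDepletionAtTwoStarPrimeLevelSeventeenByName
import Literature.NumberTheory.EllipticCurves.PrimeConductorTwoTorsionProofs
import Literature.NumberTheory.EllipticCurves.RationalTwoTorsionConductorExponentProofs
import Literature.NumberTheory.Automorphic.ShimuraCurveRibetTakahashiOptimalModularityProofs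
import Summits.BirchSwinnertonDyer.BirchSwinnertonDyer.Theorems.EisensteinDepletionAtTwoStarPlusOddClass
import HarnessLib

/-!
# The glue item `DepletedLambdaLawAtTwoModOfStar` of route `EisensteinDepletionAtTwo` — E1M ⇐ (★-GO₂) ∧ (★-OptB)

Item stmt-BirchSwinnertonDyer-24446 (support, GLUE of the gen-1 split of the crux E1M `DepletedLambdaLawAtTwoMod`,
stmt-BirchSwinnertonDyer-20341, into its children `StarGO2` (stmt-…-24444) and `StarOptB` (stmt-…-24445)):
`DepletedLambdaLawAtTwoModOfStar : StarGO2 → StarOptB → DepletedLambdaLawAtTwoMod`.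

This file is the kernel port of the sorry-free content of the registered line `star` v4.1
(`Cruxes/DepletedLambdaLawAtTwoMod/Lines/star.lean`, lead bsd-rank2-star-p1 GEN 4) with its two research stubs
`stub_starOptB` / `stub_starGO2` replaced by the hypotheses (the route-file children are the skeleton's `StarOptB` / `StarGO2`
with the local abbreviations `plusAt` / `eisAt` / `EvenOnLoop` inlined). Every other stub of the line is a tree theorem and is
used BY NAME; the only proofs written out here are the three bookkeeping glue steps of the skeleton, in the scale `g = ½`:

* `sameOnC_of_globalCongruence` — a global mod-2 congruence of the plus functional `X_f(b,d) = [b/d]⁺_f − [0]⁺_f` and the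
  stabilised-Eisenstein functional `Φ_β(b,d)` on the cusps `b/d` (`d > 0`, `gcd(d, bN) = 1`) gives the registered C-currency
  («`SameOnCModTwo`»: the normalised differences `plusCuspDiff`, `stabEisCuspDiff` on the index set `C`);
* `depthZero_of_globalCongruence` — with `8 ∣ Φ_β` globally (`star_eisEightGlobal`) and the odd C-witness of the Eisenstein side
  (`exists_inC_norm_stabEisCuspDiff_eq`), the same congruence forces an ODD curve-side C-difference (2-adic depth `0` on `C`);
* `starSymbCAll_of_starOptB_starGO2` — (★-SymbC, all levels) from the two children: conductor `15` is the tree theorem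
  `starSymbC_of_conductorNorm_eq_fifteen`; off `15`, take the X₀(N)-optimal model `(W₀, L₀, q)` of the class of `f`
  (`nonempty_modularParametrizationData_of_isNewformOf`, `exists_isGloballyMinimal_latticeEq_rat`, `IsNewformOf.unique`),
  admissible data at `N_W` from Setzer 1975 + Cremona @17 + Ogg–Saito @3 (all tree theorems, as in the skeleton's closed
  `stub_starAdmissibleHabitat`), the rational odd étale `2`-torsion point of `W₀` from `StarOptB`, its half-lattice vector and
  the plus parity from `star_plusOddClass` (scale `½`), the Eisenstein parity from `StarGO2`; the two parities agree loop by loop.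

The closer `depletedLambdaLawAtTwoModOfStar_proof` is then modus ponens through the tree theorems `star_glueFin`
(+ `starEisEight₂`, `starEisFin`) ⇒ (★-core), `starCongruence_of_starCore` ⇒ (★_S), `depletedLambdaLawAtTwoMod_of_starCongruence`
⇒ E1M. Nothing here proves `StarGO2`, `StarOptB`, E1M or BSD: the item is glue (children ⟹ parent).

References: V. Vatsal, *Multiplicative subgroups of J₀(N) and applications to elliptic curves*, J. Inst. Math. Jussieu 4
(2005) [Vatsal2005]; B. Mazur, J. Tate, J. Teitelbaum, Invent. Math. 84 (1986) §I.10–I.13 [MazurTateTeitelbaum1986Invent];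
G. Stevens, *Arithmetic on Modular Curves* (1982) [Stevens1982]; R. Greenberg, V. Vatsal, Invent. Math. 142 (2000) §3
[GreenbergVatsal2000].
-/

set_option linter.dupNamespace false
set_option autoImplicit false

noncomputable section

open _root_.WeierstrassCurve
open Literature.NumberTheory.EllipticCurves
open Literature.NumberTheory.EllipticCurves.Greenberg1999
open Literature.NumberTheory.EllipticCurves.ModularForms
open Literature.NumberTheory.Automorphic
open Summit.BirchSwinnertonDyer.BirchSwinnertonDyer.Theses.EisensteinDepletionAtTwo
open scoped MatrixGroups

namespace Summit.BirchSwinnertonDyer.BirchSwinnertonDyer.Theorems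

namespace DepletionAtTwo

section GlobalToC

variable {N M : ℕ}

/-- **Global ⇒ C.** A mod-2 congruence between the plus functional `[b/d]⁺_f − [0]⁺_f` (scale `g`) and the stabilised
Eisenstein period functional on the Bézout matrices of the cusps `b/d`, `d > 0`, `gcd(d, bM) = 1` (scale `g'`), together with an
odd curve-side C-difference at scale `g`, gives the registered C-currency: the normalised differences `plusCuspDiff f`,
`stabEisCuspDiff M β` agree mod 2 on `C` at the scales `(g, g')` (the two cusps `a/2^m`, `1/2^m` of a C-pair have the same
denominator). Port of the skeleton's `sameOnC_of_global`. [cite: MazurTateTeitelbaum1986Invent, §I.10 (10.1)]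
[cite: Stevens1982, §2.5 (PDF p. 38)] -/
theorem sameOnC_of_globalCongruence (hM : Odd M) (f : CuspForm (CongruenceSubgroup.Gamma0 N) 2) (β : ℕ → ℕ)
    {g g' : ℚ} (hg : g ≠ 0) (hg' : g' ≠ 0)
    (hcong : ∀ b d : ℤ, 0 < d → Int.gcd d (b * M) = 1 →
      ∃ n n' : ℤ, ratPlusSymbol f ((b : ℚ) / (d : ℚ)) - ratPlusSymbol f 0 = n * g ∧
        stabEisensteinPeriod M β (Int.gcdA d (b * M)) b (-(M : ℤ) * Int.gcdB d (b * M)) d = n' * g' ∧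
        (n : ZMod 2) = (n' : ZMod 2))
    (hdepth : ∃ m a, InC m a ∧ ∃ n : ℤ, plusCuspDiff f m a = n * g ∧ Odd n) :
    ∃ g g' : ℚ, g ≠ 0 ∧ g' ≠ 0 ∧
      (∀ m a, InC m a → ∃ n n' : ℤ, plusCuspDiff f m a = n * g ∧
        stabEisCuspDiff M β m a = n' * g' ∧ (n : ZMod 2) = (n' : ZMod 2)) ∧
      (∃ m a, InC m a ∧ ∃ n : ℤ, plusCuspDiff f m a = n * g ∧ Odd n) := by
  refine ⟨g, g', hg, hg', fun m a hma ↦ ?_, hdepth⟩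
  have ha : Odd a := by
    obtain ⟨-, h4, -, -⟩ := hma
    exact Int.odd_iff.mpr (by omega)
  have hd : (0 : ℤ) < ((2 ^ m : ℕ) : ℤ) := by positivity
  obtain ⟨na, na', h1, h2, h3⟩ := hcong a _ hd (int_gcd_two_pow_eq_one hM ha m)
  obtain ⟨n1, n1', h4, h5, h6⟩ := hcong 1 _ hd (int_gcd_two_pow_eq_one hM odd_one m)
  refine ⟨na - n1, na' - n1', ?_, ?_, ?_⟩
  · unfold plusCuspDiff
    push_cast at h1 h4 ⊢
    linear_combination h1 - h4
  · rw [stabEisCuspDiff_eq, h2, h5]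
    push_cast
    ring
  · push_cast
    rw [h3, h6]

/-- **Depth 0 from the global congruence.** If `[b/d]⁺_f − [0]⁺_f ≡ Φ_β(b,d)` (mod 2) at scales `(g, g')` on all cusps `b/d`
(`d > 0`, `gcd(d, bM) = 1`), the curve side is ODD at one such cusp, and `‖Φ_β(b,d)‖₂ ≤ 8⁻¹` at every such cusp, then — because
the Eisenstein C-differences have exact 2-content `8` somewhere on `C` (`exists_inC_norm_stabEisCuspDiff_eq`) — the Eisenstein
scale is pinned (`‖g'‖₂ ≤ 8⁻¹`) and some curve-side C-difference `[a/2^m]⁺ − [1/2^m]⁺` is an odd multiple of `g`.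
Port of the skeleton's `depthZero_of_global`. [cite: Stevens1982, §5.4 (PDF pp. 73–74)]
[cite: MazurTateTeitelbaum1986Invent, §I.10–I.13] -/
theorem depthZero_of_globalCongruence (hM : Odd M) (f : CuspForm (CongruenceSubgroup.Gamma0 N) 2) {β : ℕ → ℕ}
    (hadm : IsAdmissibleStabData M β) {g g' : ℚ} (hg : g ≠ 0)
    (hcong : ∀ b d : ℤ, 0 < d → Int.gcd d (b * M) = 1 →
      ∃ n n' : ℤ, ratPlusSymbol f ((b : ℚ) / (d : ℚ)) - ratPlusSymbol f 0 = n * g ∧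
        stabEisensteinPeriod M β (Int.gcdA d (b * M)) b (-(M : ℤ) * Int.gcdB d (b * M)) d = n' * g' ∧
        (n : ZMod 2) = (n' : ZMod 2))
    (hprim : ∃ b d : ℤ, 0 < d ∧ Int.gcd d (b * M) = 1 ∧
      ∃ n : ℤ, ratPlusSymbol f ((b : ℚ) / (d : ℚ)) - ratPlusSymbol f 0 = n * g ∧ Odd n)
    (hE8 : ∀ b d : ℤ, 0 < d → Int.gcd d (b * M) = 1 →
      ‖((stabEisensteinPeriod M β (Int.gcdA d (b * M)) b (-(M : ℤ) * Int.gcdB d (b * M)) d : ℚ) : ℚ_[2])‖ ≤ 8⁻¹) :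
    ∃ m a, InC m a ∧ ∃ n : ℤ, plusCuspDiff f m a = n * g ∧ Odd n := by
  -- (1) the Eisenstein scale: `‖g'‖₂ ≤ 8⁻¹`
  obtain ⟨b₀, d₀, hd₀, hcop₀, n₀, hX₀, hn₀⟩ := hprim
  obtain ⟨n, n', hX, hΦ, hnn'⟩ := hcong b₀ d₀ hd₀ hcop₀
  have hn : n = n₀ := by
    have : (n : ℚ) * g = n₀ * g := by rw [← hX, hX₀]
    exact_mod_cast mul_right_cancel₀ hg this
  subst hn
  have hn'odd : Odd n' := by
    have h2 : (2 : ℤ) ∣ n' - n := by exact_mod_cast (ZMod.intCast_eq_intCast_iff_dvd_sub n n' 2).mp hnn'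
    obtain ⟨k, hk⟩ := hn₀
    obtain ⟨c, hc⟩ := h2
    exact ⟨k + c, by omega⟩
  have hg'le : ‖((g' : ℚ) : ℚ_[2])‖ ≤ 8⁻¹ := by
    have h := hE8 b₀ d₀ hd₀ hcop₀
    rw [hΦ, Rat.cast_mul, Rat.cast_intCast, norm_mul, norm_intCast_eq_one_of_odd hn'odd, one_mul] at h
    exact h
  -- (2) the odd C-witness of the Eisenstein side pins `n'_a − n'_1` odd
  obtain ⟨m, a, hma, hv⟩ := exists_inC_norm_stabEisCuspDiff_eq hM hadm
  have ha : Odd a := by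
    obtain ⟨-, h4, -, -⟩ := hma
    exact Int.odd_iff.mpr (by omega)
  have hd : (0 : ℤ) < ((2 ^ m : ℕ) : ℤ) := by positivity
  obtain ⟨na, na', h1, h2, h3⟩ := hcong a _ hd (int_gcd_two_pow_eq_one hM ha m)
  obtain ⟨n1, n1', h4, h5, h6⟩ := hcong 1 _ hd (int_gcd_two_pow_eq_one hM odd_one m)
  have hvq : stabEisCuspDiff M β m a = (na' - n1' : ℤ) * g' := by
    rw [stabEisCuspDiff_eq, h2, h5]
    push_cast
    ring
  have hdiff_odd : Odd (na' - n1') := by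
    apply odd_of_norm_intCast_eq_one
    apply le_antisymm (Padic.norm_int_le_one _)
    by_contra hlt
    push Not at hlt
    have : ‖((stabEisCuspDiff M β m a : ℚ) : ℚ_[2])‖ < 8⁻¹ := by
      rw [hvq, Rat.cast_mul, Rat.cast_intCast, norm_mul]
      calc ‖((na' - n1' : ℤ) : ℚ_[2])‖ * ‖((g' : ℚ) : ℚ_[2])‖
          ≤ ‖((na' - n1' : ℤ) : ℚ_[2])‖ * 8⁻¹ := by gcongr
        _ < 1 * 8⁻¹ := by gcongr
        _ = 8⁻¹ := one_mul _
    exact absurd hv this.ne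
  -- (3) transfer the parity to the curve side
  refine ⟨m, a, hma, na - n1, ?_, ?_⟩
  · unfold plusCuspDiff
    push_cast at h1 h4 ⊢
    linear_combination h1 - h4
  · have e1 : (2 : ℤ) ∣ na' - na := by exact_mod_cast (ZMod.intCast_eq_intCast_iff_dvd_sub na na' 2).mp h3
    have e2 : (2 : ℤ) ∣ n1' - n1 := by exact_mod_cast (ZMod.intCast_eq_intCast_iff_dvd_sub n1 n1' 2).mp h6
    obtain ⟨k, hk⟩ := hdiff_odd
    obtain ⟨c1, hc1⟩ := e1
    obtain ⟨c2, hc2⟩ := e2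
    exact ⟨k + c2 - c1, by omega⟩

end GlobalToC

section Split

/-- **(★-SymbC, all levels) from the two children of the split** (the skeleton's `starSymbCAll_of (starSymbGlobal_of OptB GO₂
PlusOddClass) EisEightGlobal PlusPrimitive SymbFifteen AdmissibleHabitat`, run at the scale `g = ½`): for a habitat curve `W`
(globally minimal, good ordinary at `2`, a unique rational `2`-torsion point of Greenberg type A xor B) and a newform `f` of `W`,
SOME admissible stabilisation datum `β` at level `N_W` has `plusCuspDiff f ≡ stabEisCuspDiff N_W β` on `C` mod 2 in primitive
normalisations. Conductor `15`: `starSymbC_of_conductorNorm_eq_fifteen`. Off `15`: optimal model `(W₀, L₀ = q·Λ_f)` of the class,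
`StarOptB` ⇒ rational odd étale `2`-torsion `x₀` of `W₀`, `star_plusOddClass` ⇒ half-lattice vector `λ` with «`2X_f(b,d)` even ⟺
loop `{0,b/d}` even at `λ/2`», `StarGO2` ⇒ admissible `β`, scale `g'` with «`Φ_β(b,d)/g'` even ⟺ the same», hence the global
congruence at `(½, g')`; then `depthZero_of_globalCongruence` (`star_eisEightGlobal`) and `sameOnC_of_globalCongruence`.
[cite: Vatsal2005, Thm. 1.1, Thm. 1.10] [cite: MazurTateTeitelbaum1986Invent, §I.10–I.13] -/
theorem starSymbCAll_of_starOptB_starGO2 (hO : StarOptB) (hG : StarGO2) :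
    ∀ (W : WeierstrassCurve ℚ) [W.IsElliptic] [W.IsGloballyMinimal] (x : ℚ), IsOrdinaryAt W 2 →
      HasUniqueRationalTwoTorsionX W x →
      ((TwoTorsionRamifiedAtTwo x ∧ ¬ TwoTorsionOdd W x) ∨ (TwoTorsionOdd W x ∧ ¬ TwoTorsionRamifiedAtTwo x)) →
      ∀ ⦃N : ℕ⦄ [NeZero N] (f : CuspForm (CongruenceSubgroup.Gamma0 N) 2), IsNewformOf W f →
        ∃ β : ℕ → ℕ, IsAdmissibleStabData (W.conductorNorm ℤ) β ∧
          ∃ g g' : ℚ, g ≠ 0 ∧ g' ≠ 0 ∧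
            (∀ m a, InC m a → ∃ n n' : ℤ, plusCuspDiff f m a = n * g ∧
              stabEisCuspDiff (W.conductorNorm ℤ) β m a = n' * g' ∧ (n : ZMod 2) = (n' : ZMod 2)) ∧
            (∃ m a, InC m a ∧ ∃ n : ℤ, plusCuspDiff f m a = n * g ∧ Odd n) := by
  intro W _ _ x hord hx hAB N _ f hf
  classical
  by_cases h15 : W.conductorNorm ℤ = 15
  · exact starSymbC_of_conductorNorm_eq_fifteen W h15 f hf
  have hoddN : Odd (W.conductorNorm ℤ) :=
    Nat.odd_iff.mpr (Nat.two_dvd_ne_zero.mp (not_dvd_conductorNorm_of_hasGoodReductionAtPrime W hord.1))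
  -- admissible stabilisation data exist at `N_W` (Setzer 1975, Cremona's table at 17, Ogg–Saito at 3: tree theorems)
  have hadm : ∃ β : ℕ → ℕ, IsAdmissibleStabData (W.conductorNorm ℤ) β := by
    haveI : Fact (Nat.Prime 3) := ⟨Nat.prime_three⟩
    exact (exists_isAdmissibleStabData_conductorNorm_iff_of_isOrdinaryAt W hord).mpr
      ⟨starNoPrimeHabitat_of_setzer_of_twoTorsionList Setzer1975_primeConductor_rationalTwoTorsion_holds
          exists_smul_eq_of_conductorNorm_eq_seventeen W x hord hx hAB,
        factorization_conductorNorm_le_two_of_ne_two_of_hasRationalTwoTorsionX W 3 (by norm_num) hx.1⟩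
  -- the optimal model `(W₀, L₀, q)` of the class of `f`
  obtain ⟨D⟩ := nonempty_modularParametrizationData_of_isNewformOf hf
  have hDf : D.f = f := D.isNewformOf.unique hf
  obtain ⟨W₀, hW₀e, hW₀m, L₀, q, hf₀, hL₀, hq, hΛ₁, hΛ₂⟩ := D.exists_isGloballyMinimal_latticeEq_rat
  rw [hDf] at hf₀ hΛ₁ hΛ₂
  -- OptB: the rational odd étale point; PlusOddClass: its half-lattice vector and the plus parity; GO₂: the Eisenstein parity
  obtain ⟨x₀, hx₀, hodd₀, het₀⟩ := hO W x hord hx hAB h15 f hf W₀ hf₀ L₀ hL₀ q hq hΛ₁ hΛ₂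
  obtain ⟨lam, hlam, hlam2, hxlam, hplus⟩ :=
    star_plusOddClass W W₀ f hf hf₀ L₀ hL₀ q hq hΛ₁ hΛ₂ x₀ hx₀ hodd₀
  obtain ⟨β, hβ, g', hg', heis⟩ :=
    hG W W₀ f hf hf₀ hord L₀ hL₀ q hq hΛ₁ hΛ₂ x₀ hx₀ het₀ lam hlam hlam2 hxlam hadm
  -- the global congruence at the scales `(½, g')`: both parities are the loop parity at `λ/2`
  have hcong : ∀ b d : ℤ, 0 < d → Int.gcd d (b * (W.conductorNorm ℤ : ℕ)) = 1 →
      ∃ n n' : ℤ, ratPlusSymbol f ((b : ℚ) / (d : ℚ)) - ratPlusSymbol f 0 = n * (1 / 2 : ℚ) ∧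
        stabEisensteinPeriod (W.conductorNorm ℤ) β (Int.gcdA d (b * (W.conductorNorm ℤ : ℕ))) b
            (-((W.conductorNorm ℤ : ℕ) : ℤ) * Int.gcdB d (b * (W.conductorNorm ℤ : ℕ))) d = n' * g' ∧
        (n : ZMod 2) = (n' : ZMod 2) := by
    intro b d hd hcop
    obtain ⟨n, hn, hpar⟩ := hplus b d hd hcop
    obtain ⟨n', hn', hpar'⟩ := heis b d hd hcop
    refine ⟨n, n', hn, hn', ?_⟩
    have hiff : Even n' ↔ Even n := hpar'.trans hpar.symm
    have h2dvd : (2 : ℤ) ∣ n' - n := even_iff_two_dvd.mp (Int.even_sub.mpr hiff)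
    exact (ZMod.intCast_eq_intCast_iff_dvd_sub n n' 2).mpr (by exact_mod_cast h2dvd)
  have hprim := (plusFunctional_halfIntegral_and_odd W f hf).2
  have hdepth := depthZero_of_globalCongruence hoddN f hβ (by norm_num : (1 / 2 : ℚ) ≠ 0) hcong hprim
    (star_eisEightGlobal _ hoddN β hβ)
  exact ⟨β, hβ, sameOnC_of_globalCongruence hoddN f β (by norm_num) hg' hcong hdepth⟩

end Split

end DepletionAtTwo

/-- **Item stmt-BirchSwinnertonDyer-24446 (glue): `StarGO2 → StarOptB → DepletedLambdaLawAtTwoMod`.** The two children give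
(★-SymbC, all levels) (`starSymbCAll_of_starOptB_starGO2`); with (★-EisEight) `starEisEight₂` and (★-EisFin) `starEisFin` the
curve-side Λ-glue `star_glueFin` gives (★-core); `starCongruence_of_starCore` restores the depletion to get (★_S); and
`depletedLambdaLawAtTwoMod_of_starCongruence` (transfer (T) with the Kubota–Leopoldt witness (K) and the Euler orders (E)) gives the
crux E1M — the modularity hypothesis of E1M is not even used. [cite: GreenbergVatsal2000, §3 Thm. (3.12), display (28)]
[cite: MazurTateTeitelbaum1986Invent, §I.10–I.13] -/
theorem depletedLambdaLawAtTwoModOfStar_proof :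
    Summit.BirchSwinnertonDyer.BirchSwinnertonDyer.Theses.EisensteinDepletionAtTwo.DepletedLambdaLawAtTwoModOfStar := by
  unfold DepletedLambdaLawAtTwoModOfStar
  intro hG hO
  exact DepletionAtTwo.depletedLambdaLawAtTwoMod_of_starCongruence
    (DepletionAtTwo.starCongruence_of_starCore
      (DepletionAtTwo.star_glueFin (DepletionAtTwo.starSymbCAll_of_starOptB_starGO2 hO hG)
        DepletionAtTwo.starEisEight₂ DepletionAtTwo.starEisFin))

end Summit.BirchSwinnertonDyer.BirchSwinnertonDyer.Theorems

end
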